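/-
Copyright (c) 2026. Released under Apache 2.0 license.
-/
import Literature.NumberTheory.Automorphic.UnboundedDenominatorsRationalityProofs
import Literature.NumberTheory.Automorphic.UnboundedDenominatorsCor453Reduction
import Literature.NumberTheory.Automorphic.UnboundedDenominatorsInvariantHom
import HarnessLib

/-!
# CDT Theorem 1.0.1 from `hker₂` and the congruence property of `[SL₂(ℤ), Γ(N)]`

The tree's `CalegariDimitrovTang2025_unboundedDenominators.of_two_inputs` (edix-p4 g39) derives the
Unbounded Denominators theorem [CalegariDimitrovTang2025, Thm. 1.0.1] from two printed inputs: `hker₂`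
(amalgam + congruence subgroup property for `SL₂(ℤ[1/p])`, CDT Lemma 4.6.2) and `hcor` (CDT Cor. 4.5.3 in
defect form).  `UnboundedDenominatorsCor453Reduction.cor453_of_invariant_form` reduces `hcor` to its invariant
form, and `UnboundedDenominatorsInvariantHom.cor453_invariant_form_of_commutator_congruence` reduces the
invariant form to the classical group-theoretic statement

  `(T)  ∀ N ≥ 1, ∃ M ≥ 1, Γ(M) ≤ [SL₂(ℤ), Γ(N)]`

(the commutator of `SL₂(ℤ)` with a principal congruence subgroup is again a congruence subgroup; by
[Beyl1986] — Schur multiplier of `SL₂(ℤ/N)` — with `M = lcm(N,12)` for `4 ∤ N` and `M = lcm(2N,24)` for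
`4 ∣ N`; equivalently CDT Thm. 4.5.2).  This file records the composite:

* `CalegariDimitrovTang2025_unboundedDenominators.of_hker2_of_commutator_congruence` — CDT Thm. 1.0.1 from
  `hker₂` and `(T)`.

So the crux-line skeleton may carry `(T)` verbatim as its second stub.  `(T)` is NOT proved here (the tree has:
`N = 1`, `ModularGroupCommutatorCongruence`; finiteness of `[SL₂(ℤ) : [SL₂(ℤ), Γ(N)]]` and the converse
reduction, `UnboundedDenominatorsCommutatorFiniteIndex`; the lower bounds on `M`,
`UnboundedDenominatorsCommutatorLevelBound`).
-/

open scoped MatrixGroups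

namespace Literature.NumberTheory.Automorphic

open CongruenceSubgroup Matrix.SpecialLinearGroup ModularGroup UnboundedDenominators

/-- **CDT Theorem 1.0.1 from `hker₂` and the congruence property of the commutators `[SL₂(ℤ), Γ(N)]`.**
[cite: CalegariDimitrovTang2025, Theorem 1.0.1 and Corollary 4.5.3] -/
theorem CalegariDimitrovTang2025_unboundedDenominators.of_hker2_of_commutator_congruence
    (hker₂ : ∀ (N p : ℕ) (A : GL (Fin 2) ℝ), 0 < N →
      (A : Matrix (Fin 2) (Fin 2) ℝ) = !![(p : ℝ), 0; 0, 1] → p.Prime → ¬ p ∣ N →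
      ∀ (Δ : Type) [Group Δ] [Finite Δ] (g₁ g₂ : Gamma N →* Δ),
      (∀ (x : SL(2, ℤ)) (hx : x ∈ Gamma N), x ∈ Gamma0 p → ∀ (y : SL(2, ℤ)) (hy : y ∈ Gamma N),
        A * mapGL ℝ x = mapGL ℝ y * A → g₁ ⟨x, hx⟩ = g₂ ⟨y, hy⟩) →
      (∃ M : ℕ, M ≠ 0 ∧ ∀ (x : SL(2, ℤ)) (hx : x ∈ Gamma N), x ∈ Gamma M → g₁ ⟨x, hx⟩ = 1) ∧
      (∃ M : ℕ, M ≠ 0 ∧ ∀ (x : SL(2, ℤ)) (hx : x ∈ Gamma N), x ∈ Gamma M → g₂ ⟨x, hx⟩ = 1))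
    (hK : ∀ N : ℕ, N ≠ 0 → ∃ M : ℕ, M ≠ 0 ∧ Gamma M ≤ ⁅(⊤ : Subgroup SL(2, ℤ)), Gamma N⁆) :
    CalegariDimitrovTang2025_unboundedDenominators :=
  CalegariDimitrovTang2025_unboundedDenominators.of_two_inputs hker₂
    (cor453_of_invariant_form fun N Q _ _ θ hθ ↦
      cor453_invariant_form_of_commutator_congruence hK N Q θ hθ)

end Literature.NumberTheory.Automorphic
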